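/-
Copyright (c) 2026 the pub-hodgecm-mathlib formalisation cell (harness21).  Prover seat hodgecm-mathlib-K2E4-p10 (g0), Track B ∕ K2-LIT
(build stream 29), h413 = `stmt-HodgeConjecture-24833`, line `K2_E4_SingularTransferKappaSign`, socket module «ArchLimitConstant», file #10
`sig_K2E4ExplicitArchConstantPhase` — the PHASE REDUCTION «#10 ⟸ #9» (conjugation symmetry of the `Δ‴_∞`-transfer).  2026-09-03.
-/
import Literature.NumberTheory.Rogawski1990.TamagawaSingularMembersFinTFCovol   -- ★ p844690: the letters' FRAME and κ-block vocabulary (`CanonicalTransferMatrix`, `ArchCanonicalSingularMatrix`, …)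
import Literature.NumberTheory.Weil1982.UnitaryFinCentralizerTopFormHaar         -- ★ p850468 (frame import of the socket module)
import Literature.NumberTheory.Rogawski1990.FinExplicitTransferFactorConjLeft     -- ★ `finExplicitDelta_conj_left_all`  (the pinned `Δ‴` of the socket's `hΔ`)
import Literature.NumberTheory.Rogawski1990.FinExplicitTransferFactorConjRight    -- ★ `finExplicitDelta_conj_right_all`
import Literature.NumberTheory.Rogawski1990.ArchCanonicalTransferFactor           -- ★ `archCanonicalTransferFactor` = `Δ‴_∞`
import Literature.NumberTheory.Rogawski1990.ExplicitFactorProductFormula          -- ★ (frame import of the socket module)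
import Literature.NumberTheory.Automorphic.QuadraticHeckeCharacterCM              -- ★ `quadraticHeckeCharCM` (the socket's `hμω`)
import Literature.NumberTheory.Automorphic.ArchEndoscopicOrbitClosed              -- ★ `archStableOrbitalIntegralH_add_of_isArchGRegular`, `archStableOrbitalIntegralH_smul_fun` (H-side linearity at `G`-regular `γ_H`)
import Literature.NumberTheory.Rogawski1990.ArchBouazizStableFamilyLinear         -- ★ `ArchSmooth₂.add`, `ArchSmooth₂.neg`
import Summits.HodgeConjecture.HodgeConjecture.Theorems.K2E4ExplicitArchConstantPhaseConj    -- ★ helper §A (p854855): `conj` and class functions through (stable) orbital integrals; `ArchSmooth.star`, `ArchSmooth₂.star`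
import Summits.HodgeConjecture.HodgeConjecture.Theorems.K2E4ExplicitArchConstantPhaseFactor  -- ★ helper §B (p854856): `conj Δ‴_∞ · τ_∞² = Δ‴_∞`, `Δ‴_∞ ∈ τ_∞·ℝ`, `Δ‴_∞(γ_H ⊗ 1, γ₀ ⊗ 1) ≠ 0`
import Summits.HodgeConjecture.HodgeConjecture.Theorems.K2E4ExplicitArchConstantPhaseTwist   -- ★ helper §C (p854857): the smooth class cut-off `χ`, `χ·τ_∞²` multipliers of `C_c^∞(H_∞)`
import HarnessLib

/-!
# Socket #10 `sig_K2E4ExplicitArchConstantPhase` REDUCED TO socket #9 `sig_K2E4ExplicitArchSingularTransfer`: the archimedean singular-transfer constant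
# `c_∞` of the explicit factor `Δ‴_∞` is AUTOMATICALLY pinned in phase — `c_∞ · Δ‴_∞(γ_H ⊗ 1, γ₀ ⊗ 1) ∈ ℝ ∖ {0}` (Rogawski 1990, Prop. 8.2.1 proof pp. 118–119)

Cell `hodgecm-mathlib`, crux H413 = `stmt-HodgeConjecture-24833`, route of record `HCCMUnconditional`; Track B «K2-LIT» (build stream 29), line
`Cruxes/H413/Lines/K2_E4_SingularTransferKappaSign.lean`, socket module `…SigsArchLimitConstant` (U6), socket #10 `sig_K2E4ExplicitArchConstantPhase` (size L;
deps «#9 + ★ archCanonicalDelta, archGlobalSign, archExplicitDelta»).  THEOREMS ONLY (no `def`, no instance, no notation, no `sorry`); lane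
`--supports stmt-HodgeConjecture-24833 --as helper`.  Author K2E4-p10 (g0).

WHAT IS PROVED.  `ExplicitArchConstantPhase_of_kappaArch`: under the socket's frame and binders VERBATIM (the letters' ★ p844690 frame; `hCTM`, `hACS`; the pinned data
`μ`, `hμu`, `hμω`, `hΔ`, `hTinf : Tinf = archCanonicalTransferFactor L H′ μ`; print's semiregular pair `γ₀`, `γ_H = (e₁·1₂, e₂)`), THE CONCLUSION OF SOCKET #9 AT
`(γ₀, γ_H)` — «`∃ c_∞ ≠ 0`, `Φ^st_{top}(γ₀ ⊗ 1, a) = c_∞ · a^H(γ_H ⊗ 1)` for every smooth `Δ‴_∞`-pair `(a^H, a)`» — IMPLIES THE CONCLUSION OF SOCKET #10: the same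
identity with a constant `c_∞` such that `c_∞ · Δ‴_∞(γ_H ⊗ 1, γ₀ ⊗ 1)` is a NON-ZERO REAL.  So `Theorems/K2E4ExplicitArchConstantPhase.lean` is this theorem applied to
`Theorems/K2E4ExplicitArchSingularTransfer.lean` (#9, seat K2E4-p09) once the latter lands; nothing here proves #9 (Harish-Chandra's limit formula on the three
sheets, print pp. 118–119 — the XL content of the unit).

THE PROOF (conjugation symmetry; no harmonic analysis).  Write `τ = τ_∞(γ_H ⊗ 1)`, `Δ₀ = Δ‴_∞(γ_H ⊗ 1, γ₀ ⊗ 1)`.  ★ §B: `Δ₀ ≠ 0` (the pair matches and is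
`(G,H)`-regular: `χ_g(e₂) = (e₂ − e₁)² ≠ 0`), `Δ₀ = τ · r₀` with `r₀ ∈ ℝ`, and `conj Δ‴_∞(γ_H′, γ′) · τ_∞(γ_H′)² = Δ‴_∞(γ_H′, γ′)` everywhere (`μ` unitary).  If every smooth pair
vanishes at `γ_H ⊗ 1`, take `c_∞ := conj Δ₀` (`c_∞ Δ₀ = |Δ₀|² > 0`).  Otherwise fix a pair `(a^H, a)` with `a^H(γ_H ⊗ 1) ≠ 0` and let `b^H` be a smooth transfer of
`conj ∘ a` (clause (vi) of `hACS`).  With the smooth class cut-off `χ` of ★ §C (`χ(γ_H ⊗ 1) = 1`, `χ` and `χ·τ_∞²` multipliers of `C_c^∞(H_∞)`, constant on stable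
classes) the test function `d = χ · b^H − χ · τ_∞² · conj ∘ a^H ∈ C_c^∞(H_∞)` has VANISHING stable orbital integrals at every `G`-regular `γ_H′` (★ §A: `conj` and class
functions come out of `Φ^st_H`; H-side additivity ★ `archStableOrbitalIntegralH_add_of_isArchGRegular`; the identity of ★ §B termwise in the `finsum`), i.e. `(d, 0)` is a
smooth `Δ‴_∞`-pair; #9 applied to `(d, 0)` gives `c_∞ · d(γ_H ⊗ 1) = 0`, so `b^H(γ_H ⊗ 1) = τ² · conj a^H(γ_H ⊗ 1)`; #9 applied to `(b^H, conj ∘ a)` and to `(a^H, a)`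
(`Φ^st_{top}(conj ∘ a) = conj Φ^st_{top}(a)`, ★ §A) gives `conj c_∞ = c_∞ τ²`, whence `conj(c_∞ Δ₀) = c_∞ τ² · conj τ · r₀ = c_∞ τ r₀ = c_∞ Δ₀` — real, and non-zero.
[Rogawski1990, Prop. 8.2.1 proof p. 119: «there is a non-zero constant c» (L3), «the constant in the limit formula for H′ differs by a sign» (L32), «τ(γ)|A₁(γ)A₂(γ)|» (L36)].

EDITION 2 (docstring-only page fold per lit1 (5162): «Prop. 8.2.1 p. 117» → p. 118; Lean bytes unchanged).

HONEST LABEL.  Count-neutral helper (`--supports 24833 --as helper`); it pays socket #10 BY NAME only together with socket #9.  HC_CM is proved only modulo the 7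
printed citations (2 remaining named inputs: hLiu418 = stmt-HodgeConjecture-24832, h413 = stmt-HodgeConjecture-24833) until rung 0 closes.

## References
* [Rogawski1990] J. D. Rogawski, *Automorphic Representations of Unitary Groups in Three Variables*, Ann. of Math. Stud. 123 (1990), Prop. 8.2.1 p. 118 and its proof
  pp. 118–119 (held e-text `book:rogawski1990…` p0117 L5–L12, p0118 L3, L28–L36); §4.9 p. 55 (`τ`, `D_{G∕H}`, `Δ_{G∕H}`); §14.6 p. 242 (`Δ″_v`, `c = ±1`); Lemma 14.5.2 (b) pp. 238–239.
* [LanglandsShelstad1987] R. P. Langlands, D. Shelstad, *On the definition of transfer factors*, Math. Ann. 278 (1987), §1.3–1.4, §6.4.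
* [Bouaziz1994IntegralesOrbitales] A. Bouaziz, *Intégrales orbitales sur les groupes de Lie réductifs*, Ann. Sci. ÉNS (4) 27 (1994), §5.1 p. 588.
-/

set_option autoImplicit false
set_option linter.dupNamespace false

noncomputable section

open MeasureTheory Measure NumberField IsDedekindDomain
open Literature.MeasureTheory.Group Literature.MeasureTheory.RestrictedProduct
open Literature.Topology.RestrictedProduct Literature.Topology.Algebra.RestrictedProduct
open Literature.NumberTheory.Rogawski1990 Literature.NumberTheory.Automorphic
open Literature.AlgebraicGeometry.ShimuraVarieties (unitaryGroup hermForm)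
open scoped Matrix MatrixGroups RestrictedProduct ComplexConjugate

namespace Summit.HodgeConjecture.HodgeConjecture.Cruxes.H413.K2E4ExplicitArchConstantPhaseOfKappaArch

open Summit.HodgeConjecture.HodgeConjecture.Cruxes.H413.K2E4ExplicitArchConstantPhaseConj
open Summit.HodgeConjecture.HodgeConjecture.Cruxes.H413.K2E4ExplicitArchConstantPhaseFactor
open Summit.HodgeConjecture.HodgeConjecture.Cruxes.H413.K2E4ExplicitArchConstantPhaseTwist

/-! ## §1 The twisted difference `χ·b^H − χ·τ_∞²·conj a^H` is a `Δ‴_∞`-transfer of `0` -/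

section Twist

variable (L : Type) [Field L] [NumberField L] [IsCMField L] (H' : Matrix (Fin 3) (Fin 3) L) (μ : Literature.NumberTheory.GaloisRepresentations.HeckeCharacter L)
  [∀ a : (↥(UnitaryGroup.arch (↥(maximalRealSubfield L)) L (IsCMField.complexConj L) 2 (Matrix.of fun i j : Fin 2 => if i.val + j.val + 1 = 2 then (1 : L) else 0)) ×
        ↥(UnitaryGroup.arch (↥(maximalRealSubfield L)) L (IsCMField.complexConj L) 1 (Matrix.of fun i j : Fin 1 => if i.val + j.val + 1 = 1 then (1 : L) else 0))),
    MeasurableSpace ((↥(UnitaryGroup.arch (↥(maximalRealSubfield L)) L (IsCMField.complexConj L) 2 (Matrix.of fun i j : Fin 2 => if i.val + j.val + 1 = 2 then (1 : L) else 0)) ×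
        ↥(UnitaryGroup.arch (↥(maximalRealSubfield L)) L (IsCMField.complexConj L) 1 (Matrix.of fun i j : Fin 1 => if i.val + j.val + 1 = 1 then (1 : L) else 0))) ⧸ Subgroup.centralizer ({a} : Set (↥(UnitaryGroup.arch (↥(maximalRealSubfield L)) L (IsCMField.complexConj L) 2 (Matrix.of fun i j : Fin 2 => if i.val + j.val + 1 = 2 then (1 : L) else 0)) ×
        ↥(UnitaryGroup.arch (↥(maximalRealSubfield L)) L (IsCMField.complexConj L) 1 (Matrix.of fun i j : Fin 1 => if i.val + j.val + 1 = 1 then (1 : L) else 0)))))]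
  [∀ a : (↥(UnitaryGroup.arch (↥(maximalRealSubfield L)) L (IsCMField.complexConj L) 2 (Matrix.of fun i j : Fin 2 => if i.val + j.val + 1 = 2 then (1 : L) else 0)) ×
        ↥(UnitaryGroup.arch (↥(maximalRealSubfield L)) L (IsCMField.complexConj L) 1 (Matrix.of fun i j : Fin 1 => if i.val + j.val + 1 = 1 then (1 : L) else 0))),
    BorelSpace ((↥(UnitaryGroup.arch (↥(maximalRealSubfield L)) L (IsCMField.complexConj L) 2 (Matrix.of fun i j : Fin 2 => if i.val + j.val + 1 = 2 then (1 : L) else 0)) ×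
        ↥(UnitaryGroup.arch (↥(maximalRealSubfield L)) L (IsCMField.complexConj L) 1 (Matrix.of fun i j : Fin 1 => if i.val + j.val + 1 = 1 then (1 : L) else 0))) ⧸ Subgroup.centralizer ({a} : Set (↥(UnitaryGroup.arch (↥(maximalRealSubfield L)) L (IsCMField.complexConj L) 2 (Matrix.of fun i j : Fin 2 => if i.val + j.val + 1 = 2 then (1 : L) else 0)) ×
        ↥(UnitaryGroup.arch (↥(maximalRealSubfield L)) L (IsCMField.complexConj L) 1 (Matrix.of fun i j : Fin 1 => if i.val + j.val + 1 = 1 then (1 : L) else 0)))))]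
  [∀ γ : ↥(UnitaryGroup.arch (↥(maximalRealSubfield L)) L (IsCMField.complexConj L) 3 H'), MeasurableSpace (↥(UnitaryGroup.arch (↥(maximalRealSubfield L)) L (IsCMField.complexConj L) 3 H') ⧸ Subgroup.centralizer ({γ} : Set ↥(UnitaryGroup.arch (↥(maximalRealSubfield L)) L (IsCMField.complexConj L) 3 H')))]

/-- **THE TWISTED DIFFERENCE IS A `Δ‴_∞`-TRANSFER OF ZERO.**  For `μ` unitary, `(a^H, a)` and `(b^H, conj ∘ a)` smooth `Δ‴_∞`-pairs (family `m^H` admissible on the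
`G`-regular classes) and a class function `χ` on `H_∞` (conjugation invariant, constant on stable classes) such that `χ·b^H` and `−χ·τ_∞²·conj a^H` lie in
`C_c^∞(H_∞)`: the stable orbital integrals of `d = χ·b^H − χ·τ_∞²·conj a^H` VANISH at every `G`-regular `γ_H′` — `Φ^st_H(γ_H′, d) = χ(γ_H′)·[Σ Δ‴ Φ(conj a) −
τ_∞(γ_H′)²·conj Σ Δ‴ Φ(a)] = 0` termwise by `conj Δ‴_∞ · τ_∞² = Δ‴_∞` (★ §B) and `Φ([γ′], conj ∘ a) = conj Φ([γ′], a)` (★ §A).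
[cite: Rogawski1990, §4.3 (4.3.1) p. 43; Prop. 8.2.1 proof pp. 118–119] [cite: Bouaziz1994IntegralesOrbitales, §5.1 p. 588] -/
theorem isArchDeltaTransfer_cutoff_sub_zero (hμu : μ.IsUnitary)
    {mHi : OrbitalMeasureFamily (↥(UnitaryGroup.arch (↥(maximalRealSubfield L)) L (IsCMField.complexConj L) 2 (Matrix.of fun i j : Fin 2 => if i.val + j.val + 1 = 2 then (1 : L) else 0)) ×
        ↥(UnitaryGroup.arch (↥(maximalRealSubfield L)) L (IsCMField.complexConj L) 1 (Matrix.of fun i j : Fin 1 => if i.val + j.val + 1 = 1 then (1 : L) else 0)))}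
    (hadmH : mHi.IsAdmissibleOn (IsArchGRegular L)) (m' : OrbitalMeasureFamily ↥(UnitaryGroup.arch (↥(maximalRealSubfield L)) L (IsCMField.complexConj L) 3 H'))
    {aH bH : (↥(UnitaryGroup.arch (↥(maximalRealSubfield L)) L (IsCMField.complexConj L) 2 (Matrix.of fun i j : Fin 2 => if i.val + j.val + 1 = 2 then (1 : L) else 0)) ×
        ↥(UnitaryGroup.arch (↥(maximalRealSubfield L)) L (IsCMField.complexConj L) 1 (Matrix.of fun i j : Fin 1 => if i.val + j.val + 1 = 1 then (1 : L) else 0))) → ℂ}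
    {a : ↥(UnitaryGroup.arch (↥(maximalRealSubfield L)) L (IsCMField.complexConj L) 3 H') → ℂ}
    (hp : IsArchDeltaTransfer L H' (archCanonicalTransferFactor L H' μ) mHi m' aH a)
    (hbp : IsArchDeltaTransfer L H' (archCanonicalTransferFactor L H' μ) mHi m' bH (star a))
    {χ : (↥(UnitaryGroup.arch (↥(maximalRealSubfield L)) L (IsCMField.complexConj L) 2 (Matrix.of fun i j : Fin 2 => if i.val + j.val + 1 = 2 then (1 : L) else 0)) ×
        ↥(UnitaryGroup.arch (↥(maximalRealSubfield L)) L (IsCMField.complexConj L) 1 (Matrix.of fun i j : Fin 1 => if i.val + j.val + 1 = 1 then (1 : L) else 0))) → ℂ}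
    (hχconj : ∀ x y : (↥(UnitaryGroup.arch (↥(maximalRealSubfield L)) L (IsCMField.complexConj L) 2 (Matrix.of fun i j : Fin 2 => if i.val + j.val + 1 = 2 then (1 : L) else 0)) ×
        ↥(UnitaryGroup.arch (↥(maximalRealSubfield L)) L (IsCMField.complexConj L) 1 (Matrix.of fun i j : Fin 1 => if i.val + j.val + 1 = 1 then (1 : L) else 0))), χ (y * x * y⁻¹) = χ x)
    (hχst : ∀ x y : (↥(UnitaryGroup.arch (↥(maximalRealSubfield L)) L (IsCMField.complexConj L) 2 (Matrix.of fun i j : Fin 2 => if i.val + j.val + 1 = 2 then (1 : L) else 0)) ×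
        ↥(UnitaryGroup.arch (↥(maximalRealSubfield L)) L (IsCMField.complexConj L) 1 (Matrix.of fun i j : Fin 1 => if i.val + j.val + 1 = 1 then (1 : L) else 0))), IsArchStablyConjH L x y → χ y = χ x)
    (hsd₁ : ArchSmooth₂ L (fun k => χ k * bH k)) (hsd₂ : ArchSmooth₂ L ((-1 : ℂ) • fun k => χ k * (archTau L k μ ^ 2 * star aH k))) :
    IsArchDeltaTransfer L H' (archCanonicalTransferFactor L H' μ) mHi m' ((fun k => χ k * bH k) + (-1 : ℂ) • fun k => χ k * (archTau L k μ ^ 2 * star aH k)) 0 := by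
  have hτconj : ∀ x y : (↥(UnitaryGroup.arch (↥(maximalRealSubfield L)) L (IsCMField.complexConj L) 2 (Matrix.of fun i j : Fin 2 => if i.val + j.val + 1 = 2 then (1 : L) else 0)) ×
        ↥(UnitaryGroup.arch (↥(maximalRealSubfield L)) L (IsCMField.complexConj L) 1 (Matrix.of fun i j : Fin 1 => if i.val + j.val + 1 = 1 then (1 : L) else 0))),
      archTau L (y * x * y⁻¹) μ ^ 2 = archTau L x μ ^ 2 := fun x y => by rw [archTau_conj L x y μ]
  intro x hx
  have hR : ∑ᶠ c : ConjClasses ↥(UnitaryGroup.arch (↥(maximalRealSubfield L)) L (IsCMField.complexConj L) 3 H'),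
      (archCanonicalTransferFactor L H' μ).Δ x (Quotient.out c) * classOrbitalIntegral m' (0 : ↥(UnitaryGroup.arch (↥(maximalRealSubfield L)) L (IsCMField.complexConj L) 3 H') → ℂ) c = 0 := by
    simp only [classOrbitalIntegral_zero_fun, mul_zero, finsum_zero]
  rw [hR, UnitaryGroup.archStableOrbitalIntegralH_add_of_isArchGRegular L x hx hadmH hsd₁.continuous hsd₁.hasCompactSupport hsd₂.continuous hsd₂.hasCompactSupport,
    UnitaryGroup.archStableOrbitalIntegralH_smul_fun,
    stableOrbitalIntegralRel_mul_of_forall_conj _ mHi hχconj x (fun y hy => hχst x y hy) bH,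
    stableOrbitalIntegralRel_mul_of_forall_conj _ mHi hχconj x (fun y hy => hχst x y hy) (fun k => archTau L k μ ^ 2 * star aH k),
    stableOrbitalIntegralRel_mul_of_forall_conj _ mHi hτconj x (fun y hy => by rw [archTau_eq_of_isArchStablyConjH L x y μ hy]) (star aH),
    stableOrbitalIntegralRel_star, hbp x hx, hp x hx]
  have key : ∑ᶠ c : ConjClasses ↥(UnitaryGroup.arch (↥(maximalRealSubfield L)) L (IsCMField.complexConj L) 3 H'),
        (archCanonicalTransferFactor L H' μ).Δ x (Quotient.out c) * classOrbitalIntegral m' (star a) c =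
      archTau L x μ ^ 2 * conj (∑ᶠ c : ConjClasses ↥(UnitaryGroup.arch (↥(maximalRealSubfield L)) L (IsCMField.complexConj L) 3 H'),
        (archCanonicalTransferFactor L H' μ).Δ x (Quotient.out c) * classOrbitalIntegral m' a c) := by
    rw [show conj (∑ᶠ c : ConjClasses ↥(UnitaryGroup.arch (↥(maximalRealSubfield L)) L (IsCMField.complexConj L) 3 H'),
          (archCanonicalTransferFactor L H' μ).Δ x (Quotient.out c) * classOrbitalIntegral m' a c) =
        starAddEquiv (∑ᶠ c : ConjClasses ↥(UnitaryGroup.arch (↥(maximalRealSubfield L)) L (IsCMField.complexConj L) 3 H'),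
          (archCanonicalTransferFactor L H' μ).Δ x (Quotient.out c) * classOrbitalIntegral m' a c) from rfl,
      AddEquiv.map_finsum, ← smul_eq_mul, smul_finsum]
    refine finsum_congr fun c => ?_
    rw [smul_eq_mul, classOrbitalIntegral_star]
    show _ = archTau L x μ ^ 2 * conj ((archCanonicalTransferFactor L H' μ).Δ x (Quotient.out c) * classOrbitalIntegral m' a c)
    rw [map_mul, ← mul_assoc, mul_comm (archTau L x μ ^ 2), conj_archCanonicalDelta_mul_archTau_sq L H' μ x _ hμu]
  rw [key]
  ring

end Twist

/-! ## §2 The reduction «#10 ⟸ #9» under the socket frame -/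

section Frame

variable (L : Type) [Field L] [NumberField L] [IsCMField L]

variable (H' : Matrix (Fin 3) (Fin 3) L) (Tinf : ArchTransferFactor L H')
    -- σ-algebras of the `G′` side (★ (O10-c5) block), of `H_v`, `G_∞`, `H_∞`, and the Haar data — EXACTLY ★ `SingularEllipticTransfer`'s binders
    [∀ g : (UnitaryGroup.cmDatum L 3 H').Adelic, MeasurableSpace ((UnitaryGroup.cmDatum L 3 H').Adelic ⧸ Subgroup.centralizer ({g} : Set (UnitaryGroup.cmDatum L 3 H').Adelic))]
    [∀ g : (UnitaryGroup.cmDatum L 3 H').Adelic, BorelSpace ((UnitaryGroup.cmDatum L 3 H').Adelic ⧸ Subgroup.centralizer ({g} : Set (UnitaryGroup.cmDatum L 3 H').Adelic))]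
    [∀ γ : UnitaryGroup.arch (↥(maximalRealSubfield L)) L (IsCMField.complexConj L) 3 H',
      MeasurableSpace (UnitaryGroup.arch (↥(maximalRealSubfield L)) L (IsCMField.complexConj L) 3 H' ⧸ Subgroup.centralizer ({γ} : Set (UnitaryGroup.arch (↥(maximalRealSubfield L)) L (IsCMField.complexConj L) 3 H')))]
    [∀ γ : UnitaryGroup.arch (↥(maximalRealSubfield L)) L (IsCMField.complexConj L) 3 H',
      BorelSpace (UnitaryGroup.arch (↥(maximalRealSubfield L)) L (IsCMField.complexConj L) 3 H' ⧸ Subgroup.centralizer ({γ} : Set (UnitaryGroup.arch (↥(maximalRealSubfield L)) L (IsCMField.complexConj L) 3 H')))]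
    [∀ (v : HeightOneSpectrum (𝓞 ↥(maximalRealSubfield L))) (γ : (UnitaryGroup.cmDatum L 3 H').Local v),
      MeasurableSpace ((UnitaryGroup.cmDatum L 3 H').Local v ⧸ Subgroup.centralizer ({γ} : Set ((UnitaryGroup.cmDatum L 3 H').Local v)))]
    [∀ (v : HeightOneSpectrum (𝓞 ↥(maximalRealSubfield L))) (γ : (UnitaryGroup.cmDatum L 3 H').Local v),
      BorelSpace ((UnitaryGroup.cmDatum L 3 H').Local v ⧸ Subgroup.centralizer ({γ} : Set ((UnitaryGroup.cmDatum L 3 H').Local v)))]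
    [∀ v : HeightOneSpectrum (𝓞 ↥(maximalRealSubfield L)), MeasurableSpace ((UnitaryGroup.cmDatum L 3 H').Local v)] [∀ v : HeightOneSpectrum (𝓞 ↥(maximalRealSubfield L)), BorelSpace ((UnitaryGroup.cmDatum L 3 H').Local v)]
    [MeasurableSpace (UnitaryGroup.cmDatum L 3 H').Adelic] [BorelSpace (UnitaryGroup.cmDatum L 3 H').Adelic]
    [MeasurableSpace (UnitaryGroup.arch (↥(maximalRealSubfield L)) L (IsCMField.complexConj L) 3 H')] [BorelSpace (UnitaryGroup.arch (↥(maximalRealSubfield L)) L (IsCMField.complexConj L) 3 H')]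
    [∀ γ : (UnitaryGroup.cmDatum L 3 H').Adelic, MeasurableSpace (↥(Subgroup.centralizer ({γ} : Set (UnitaryGroup.cmDatum L 3 H').Adelic)) ⧸
      ((UnitaryGroup.cmDatum L 3 H').quotientSubgroup ⊓ Subgroup.centralizer ({γ} : Set (UnitaryGroup.cmDatum L 3 H').Adelic)).subgroupOf (Subgroup.centralizer ({γ} : Set (UnitaryGroup.cmDatum L 3 H').Adelic)))]
    [∀ γ : (UnitaryGroup.cmDatum L 3 H').Adelic, BorelSpace (↥(Subgroup.centralizer ({γ} : Set (UnitaryGroup.cmDatum L 3 H').Adelic)) ⧸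
      ((UnitaryGroup.cmDatum L 3 H').quotientSubgroup ⊓ Subgroup.centralizer ({γ} : Set (UnitaryGroup.cmDatum L 3 H').Adelic)).subgroupOf (Subgroup.centralizer ({γ} : Set (UnitaryGroup.cmDatum L 3 H').Adelic)))]
    [hCcl : ∀ γ : (UnitaryGroup.cmDatum L 3 H').Adelic, IsClosed ((Subgroup.centralizer ({γ} : Set (UnitaryGroup.cmDatum L 3 H').Adelic) : Subgroup (UnitaryGroup.cmDatum L 3 H').Adelic) : Set (UnitaryGroup.cmDatum L 3 H').Adelic)]
    [∀ γ : (UnitaryGroup.cmDatum L 3 H').Adelic, (count : Measure ↥(((UnitaryGroup.cmDatum L 3 H').quotientSubgroup ⊓ Subgroup.centralizer ({γ} : Set (UnitaryGroup.cmDatum L 3 H').Adelic)).subgroupOf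
      (Subgroup.centralizer ({γ} : Set (UnitaryGroup.cmDatum L 3 H').Adelic)))).IsHaarMeasure]
    [∀ v : HeightOneSpectrum (𝓞 ↥(maximalRealSubfield L)), MeasurableSpace ((UnitaryGroup.cmDatum L 2 (Matrix.of fun i j : Fin 2 => if i.val + j.val + 1 = 2 then (1 : L) else 0)).Local v ×
        (UnitaryGroup.cmDatum L 1 (Matrix.of fun i j : Fin 1 => if i.val + j.val + 1 = 1 then (1 : L) else 0)).Local v)]
    [∀ v : HeightOneSpectrum (𝓞 ↥(maximalRealSubfield L)), BorelSpace ((UnitaryGroup.cmDatum L 2 (Matrix.of fun i j : Fin 2 => if i.val + j.val + 1 = 2 then (1 : L) else 0)).Local v ×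
        (UnitaryGroup.cmDatum L 1 (Matrix.of fun i j : Fin 1 => if i.val + j.val + 1 = 1 then (1 : L) else 0)).Local v)]
    [∀ (v : HeightOneSpectrum (𝓞 ↥(maximalRealSubfield L))) (a : ((UnitaryGroup.cmDatum L 2 (Matrix.of fun i j : Fin 2 => if i.val + j.val + 1 = 2 then (1 : L) else 0)).Local v ×
        (UnitaryGroup.cmDatum L 1 (Matrix.of fun i j : Fin 1 => if i.val + j.val + 1 = 1 then (1 : L) else 0)).Local v)),
      MeasurableSpace (((UnitaryGroup.cmDatum L 2 (Matrix.of fun i j : Fin 2 => if i.val + j.val + 1 = 2 then (1 : L) else 0)).Local v ×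
        (UnitaryGroup.cmDatum L 1 (Matrix.of fun i j : Fin 1 => if i.val + j.val + 1 = 1 then (1 : L) else 0)).Local v) ⧸ Subgroup.centralizer ({a} : Set ((UnitaryGroup.cmDatum L 2 (Matrix.of fun i j : Fin 2 => if i.val + j.val + 1 = 2 then (1 : L) else 0)).Local v ×
        (UnitaryGroup.cmDatum L 1 (Matrix.of fun i j : Fin 1 => if i.val + j.val + 1 = 1 then (1 : L) else 0)).Local v)))]
    [∀ (v : HeightOneSpectrum (𝓞 ↥(maximalRealSubfield L))) (a : ((UnitaryGroup.cmDatum L 2 (Matrix.of fun i j : Fin 2 => if i.val + j.val + 1 = 2 then (1 : L) else 0)).Local v ×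
        (UnitaryGroup.cmDatum L 1 (Matrix.of fun i j : Fin 1 => if i.val + j.val + 1 = 1 then (1 : L) else 0)).Local v)),
      BorelSpace (((UnitaryGroup.cmDatum L 2 (Matrix.of fun i j : Fin 2 => if i.val + j.val + 1 = 2 then (1 : L) else 0)).Local v ×
        (UnitaryGroup.cmDatum L 1 (Matrix.of fun i j : Fin 1 => if i.val + j.val + 1 = 1 then (1 : L) else 0)).Local v) ⧸ Subgroup.centralizer ({a} : Set ((UnitaryGroup.cmDatum L 2 (Matrix.of fun i j : Fin 2 => if i.val + j.val + 1 = 2 then (1 : L) else 0)).Local v ×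
        (UnitaryGroup.cmDatum L 1 (Matrix.of fun i j : Fin 1 => if i.val + j.val + 1 = 1 then (1 : L) else 0)).Local v)))]
    [MeasurableSpace (UnitaryGroup.arch (↥(maximalRealSubfield L)) L (IsCMField.complexConj L) 3 (Matrix.of fun i j : Fin 3 => if i.val + j.val + 1 = 3 then (1 : L) else 0))] [BorelSpace (UnitaryGroup.arch (↥(maximalRealSubfield L)) L (IsCMField.complexConj L) 3 (Matrix.of fun i j : Fin 3 => if i.val + j.val + 1 = 3 then (1 : L) else 0))]
    [∀ γ : UnitaryGroup.arch (↥(maximalRealSubfield L)) L (IsCMField.complexConj L) 3 (Matrix.of fun i j : Fin 3 => if i.val + j.val + 1 = 3 then (1 : L) else 0),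
      MeasurableSpace (UnitaryGroup.arch (↥(maximalRealSubfield L)) L (IsCMField.complexConj L) 3 (Matrix.of fun i j : Fin 3 => if i.val + j.val + 1 = 3 then (1 : L) else 0) ⧸ Subgroup.centralizer ({γ} : Set (UnitaryGroup.arch (↥(maximalRealSubfield L)) L (IsCMField.complexConj L) 3 (Matrix.of fun i j : Fin 3 => if i.val + j.val + 1 = 3 then (1 : L) else 0))))]
    [∀ γ : UnitaryGroup.arch (↥(maximalRealSubfield L)) L (IsCMField.complexConj L) 3 (Matrix.of fun i j : Fin 3 => if i.val + j.val + 1 = 3 then (1 : L) else 0),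
      BorelSpace (UnitaryGroup.arch (↥(maximalRealSubfield L)) L (IsCMField.complexConj L) 3 (Matrix.of fun i j : Fin 3 => if i.val + j.val + 1 = 3 then (1 : L) else 0) ⧸ Subgroup.centralizer ({γ} : Set (UnitaryGroup.arch (↥(maximalRealSubfield L)) L (IsCMField.complexConj L) 3 (Matrix.of fun i j : Fin 3 => if i.val + j.val + 1 = 3 then (1 : L) else 0))))]
    [MeasurableSpace (UnitaryGroup.arch (↥(maximalRealSubfield L)) L (IsCMField.complexConj L) 2 (Matrix.of fun i j : Fin 2 => if i.val + j.val + 1 = 2 then (1 : L) else 0) ×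
          UnitaryGroup.arch (↥(maximalRealSubfield L)) L (IsCMField.complexConj L) 1 (Matrix.of fun i j : Fin 1 => if i.val + j.val + 1 = 1 then (1 : L) else 0))]
    [BorelSpace (UnitaryGroup.arch (↥(maximalRealSubfield L)) L (IsCMField.complexConj L) 2 (Matrix.of fun i j : Fin 2 => if i.val + j.val + 1 = 2 then (1 : L) else 0) ×
          UnitaryGroup.arch (↥(maximalRealSubfield L)) L (IsCMField.complexConj L) 1 (Matrix.of fun i j : Fin 1 => if i.val + j.val + 1 = 1 then (1 : L) else 0))]
    [∀ a : (UnitaryGroup.arch (↥(maximalRealSubfield L)) L (IsCMField.complexConj L) 2 (Matrix.of fun i j : Fin 2 => if i.val + j.val + 1 = 2 then (1 : L) else 0) ×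
          UnitaryGroup.arch (↥(maximalRealSubfield L)) L (IsCMField.complexConj L) 1 (Matrix.of fun i j : Fin 1 => if i.val + j.val + 1 = 1 then (1 : L) else 0)),
      MeasurableSpace ((UnitaryGroup.arch (↥(maximalRealSubfield L)) L (IsCMField.complexConj L) 2 (Matrix.of fun i j : Fin 2 => if i.val + j.val + 1 = 2 then (1 : L) else 0) ×
          UnitaryGroup.arch (↥(maximalRealSubfield L)) L (IsCMField.complexConj L) 1 (Matrix.of fun i j : Fin 1 => if i.val + j.val + 1 = 1 then (1 : L) else 0)) ⧸ Subgroup.centralizer ({a} : Set (UnitaryGroup.arch (↥(maximalRealSubfield L)) L (IsCMField.complexConj L) 2 (Matrix.of fun i j : Fin 2 => if i.val + j.val + 1 = 2 then (1 : L) else 0) ×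
          UnitaryGroup.arch (↥(maximalRealSubfield L)) L (IsCMField.complexConj L) 1 (Matrix.of fun i j : Fin 1 => if i.val + j.val + 1 = 1 then (1 : L) else 0))))]
    [∀ a : (UnitaryGroup.arch (↥(maximalRealSubfield L)) L (IsCMField.complexConj L) 2 (Matrix.of fun i j : Fin 2 => if i.val + j.val + 1 = 2 then (1 : L) else 0) ×
          UnitaryGroup.arch (↥(maximalRealSubfield L)) L (IsCMField.complexConj L) 1 (Matrix.of fun i j : Fin 1 => if i.val + j.val + 1 = 1 then (1 : L) else 0)),
      BorelSpace ((UnitaryGroup.arch (↥(maximalRealSubfield L)) L (IsCMField.complexConj L) 2 (Matrix.of fun i j : Fin 2 => if i.val + j.val + 1 = 2 then (1 : L) else 0) ×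
          UnitaryGroup.arch (↥(maximalRealSubfield L)) L (IsCMField.complexConj L) 1 (Matrix.of fun i j : Fin 1 => if i.val + j.val + 1 = 1 then (1 : L) else 0)) ⧸ Subgroup.centralizer ({a} : Set (UnitaryGroup.arch (↥(maximalRealSubfield L)) L (IsCMField.complexConj L) 2 (Matrix.of fun i j : Fin 2 => if i.val + j.val + 1 = 2 then (1 : L) else 0) ×
          UnitaryGroup.arch (↥(maximalRealSubfield L)) L (IsCMField.complexConj L) 1 (Matrix.of fun i j : Fin 1 => if i.val + j.val + 1 = 1 then (1 : L) else 0))))]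
    (νH : ∀ v : HeightOneSpectrum (𝓞 ↥(maximalRealSubfield L)), Measure ((UnitaryGroup.cmDatum L 2 (Matrix.of fun i j : Fin 2 => if i.val + j.val + 1 = 2 then (1 : L) else 0)).Local v ×
        (UnitaryGroup.cmDatum L 1 (Matrix.of fun i j : Fin 1 => if i.val + j.val + 1 = 1 then (1 : L) else 0)).Local v))
    (νG : ∀ v : HeightOneSpectrum (𝓞 ↥(maximalRealSubfield L)), Measure ((UnitaryGroup.cmDatum L 3 H').Local v))
    [∀ v, IsFiniteMeasureOnCompacts (νH v)] [∀ v, (νH v).IsMulRightInvariant]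
    [∀ v, (νG v).IsHaarMeasure] [∀ v, (νG v).IsMulRightInvariant]  -- MAIN-b's strength (F2): `νG_v` Haar
    (νGi : Measure (UnitaryGroup.arch (↥(maximalRealSubfield L)) L (IsCMField.complexConj L) 3 H')) (νqi : Measure (UnitaryGroup.arch (↥(maximalRealSubfield L)) L (IsCMField.complexConj L) 3 (Matrix.of fun i j : Fin 3 => if i.val + j.val + 1 = 3 then (1 : L) else 0)))
    (νHi : Measure (UnitaryGroup.arch (↥(maximalRealSubfield L)) L (IsCMField.complexConj L) 2 (Matrix.of fun i j : Fin 2 => if i.val + j.val + 1 = 2 then (1 : L) else 0) ×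
          UnitaryGroup.arch (↥(maximalRealSubfield L)) L (IsCMField.complexConj L) 1 (Matrix.of fun i j : Fin 1 => if i.val + j.val + 1 = 1 then (1 : L) else 0)))
    [IsFiniteMeasureOnCompacts νGi] [νGi.IsMulRightInvariant] [IsFiniteMeasureOnCompacts νqi] [νqi.IsMulRightInvariant]
    [IsFiniteMeasureOnCompacts νHi] [νHi.IsMulRightInvariant]

omit
    [∀ g : (UnitaryGroup.cmDatum L 3 H').Adelic, MeasurableSpace ((UnitaryGroup.cmDatum L 3 H').Adelic ⧸ Subgroup.centralizer ({g} : Set (UnitaryGroup.cmDatum L 3 H').Adelic))]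
    [MeasurableSpace (UnitaryGroup.cmDatum L 3 H').Adelic]
    [∀ γ : (UnitaryGroup.cmDatum L 3 H').Adelic, MeasurableSpace (↥(Subgroup.centralizer ({γ} : Set (UnitaryGroup.cmDatum L 3 H').Adelic)) ⧸
      ((UnitaryGroup.cmDatum L 3 H').quotientSubgroup ⊓ Subgroup.centralizer ({γ} : Set (UnitaryGroup.cmDatum L 3 H').Adelic)).subgroupOf (Subgroup.centralizer ({γ} : Set (UnitaryGroup.cmDatum L 3 H').Adelic)))]
    [∀ g : (UnitaryGroup.cmDatum L 3 H').Adelic, BorelSpace ((UnitaryGroup.cmDatum L 3 H').Adelic ⧸ Subgroup.centralizer ({g} : Set (UnitaryGroup.cmDatum L 3 H').Adelic))]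
    [BorelSpace (UnitaryGroup.cmDatum L 3 H').Adelic]
    [∀ γ : (UnitaryGroup.cmDatum L 3 H').Adelic, BorelSpace (↥(Subgroup.centralizer ({γ} : Set (UnitaryGroup.cmDatum L 3 H').Adelic)) ⧸
      ((UnitaryGroup.cmDatum L 3 H').quotientSubgroup ⊓ Subgroup.centralizer ({γ} : Set (UnitaryGroup.cmDatum L 3 H').Adelic)).subgroupOf (Subgroup.centralizer ({γ} : Set (UnitaryGroup.cmDatum L 3 H').Adelic)))]
    hCcl
    [∀ γ : (UnitaryGroup.cmDatum L 3 H').Adelic, (count : Measure ↥(((UnitaryGroup.cmDatum L 3 H').quotientSubgroup ⊓ Subgroup.centralizer ({γ} : Set (UnitaryGroup.cmDatum L 3 H').Adelic)).subgroupOf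
      (Subgroup.centralizer ({γ} : Set (UnitaryGroup.cmDatum L 3 H').Adelic)))).IsHaarMeasure] in
/-- **SOCKET #10 ⟸ SOCKET #9 (the phase of the archimedean singular-transfer constant is automatic).**  Under the frame and binders of
`…SigsArchLimitConstant.sig_K2E4ExplicitArchConstantPhase` VERBATIM, the conclusion of `sig_K2E4ExplicitArchSingularTransfer` at `(γ₀, γ_H)` (last hypothesis) implies the
conclusion of `sig_K2E4ExplicitArchConstantPhase`: `∃ c_∞`, `c_∞ · Δ‴_∞(γ_H ⊗ 1, γ₀ ⊗ 1) ∈ ℝ ∖ {0}`, and `Φ^st_{top}(γ₀ ⊗ 1, a) = c_∞ · a^H(γ_H ⊗ 1)` on every smooth `Δ‴_∞`-pair.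
Proof: conjugation symmetry of the transfer relation (file header, §1).
[cite: Rogawski1990, Prop. 8.2.1 proof pp. 118–119; §4.9 p. 55; §14.6 p. 242] [cite: LanglandsShelstad1987, §6.4] -/
theorem ExplicitArchConstantPhase_of_kappaArch :
        ∀ (hK : ∀ v : HeightOneSpectrum (𝓞 ↥(maximalRealSubfield L)), νG v (UnitaryGroup.cmLocalIntegralLevel L 3 H' v : Set ((UnitaryGroup.cmDatum L 3 H').Local v)) = 1)
          (hanis : ∀ x : Fin 3 → L, hermForm (cmConjRingHom L) H' x x = 0 → x = 0)
          (Sbad : Finset (HeightOneSpectrum (𝓞 ↥(maximalRealSubfield L))))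
              (Δ : ∀ v : HeightOneSpectrum (𝓞 ↥(maximalRealSubfield L)), LocalTransferFactor L H' v)
              (mH : ∀ v : HeightOneSpectrum (𝓞 ↥(maximalRealSubfield L)),
                OrbitalMeasureFamily ((UnitaryGroup.cmDatum L 2 (Matrix.of fun i j : Fin 2 => if i.val + j.val + 1 = 2 then (1 : L) else 0)).Local v ×
                  (UnitaryGroup.cmDatum L 1 (Matrix.of fun i j : Fin 1 => if i.val + j.val + 1 = 1 then (1 : L) else 0)).Local v))
              (mG : ∀ v : HeightOneSpectrum (𝓞 ↥(maximalRealSubfield L)), OrbitalMeasureFamily ((UnitaryGroup.cmDatum L 3 H').Local v))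
          (m' : OrbitalMeasureFamily (UnitaryGroup.arch (↥(maximalRealSubfield L)) L (IsCMField.complexConj L) 3 H'))
                (m : OrbitalMeasureFamily (UnitaryGroup.arch (↥(maximalRealSubfield L)) L (IsCMField.complexConj L) 3
                  (Matrix.of fun i j : Fin 3 => if i.val + j.val + 1 = 3 then (1 : L) else 0)))
                (mHi : OrbitalMeasureFamily (UnitaryGroup.arch (↥(maximalRealSubfield L)) L (IsCMField.complexConj L) 2
                    (Matrix.of fun i j : Fin 2 => if i.val + j.val + 1 = 2 then (1 : L) else 0) ×
                  UnitaryGroup.arch (↥(maximalRealSubfield L)) L (IsCMField.complexConj L) 1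
                    (Matrix.of fun i j : Fin 1 => if i.val + j.val + 1 = 1 then (1 : L) else 0)))
                (t' : ∀ γ' : UnitaryGroup.arch (↥(maximalRealSubfield L)) L (IsCMField.complexConj L) 3 H',
                  Measure (Subgroup.centralizer ({γ'} : Set (UnitaryGroup.arch (↥(maximalRealSubfield L)) L (IsCMField.complexConj L) 3 H'))))
                (t : ∀ γ : UnitaryGroup.arch (↥(maximalRealSubfield L)) L (IsCMField.complexConj L) 3
                    (Matrix.of fun i j : Fin 3 => if i.val + j.val + 1 = 3 then (1 : L) else 0),
                  Measure (Subgroup.centralizer ({γ} : Set (UnitaryGroup.arch (↥(maximalRealSubfield L)) L (IsCMField.complexConj L) 3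
                    (Matrix.of fun i j : Fin 3 => if i.val + j.val + 1 = 3 then (1 : L) else 0)))))
                (tH : ∀ γH : UnitaryGroup.arch (↥(maximalRealSubfield L)) L (IsCMField.complexConj L) 2
                      (Matrix.of fun i j : Fin 2 => if i.val + j.val + 1 = 2 then (1 : L) else 0) ×
                    UnitaryGroup.arch (↥(maximalRealSubfield L)) L (IsCMField.complexConj L) 1
                      (Matrix.of fun i j : Fin 1 => if i.val + j.val + 1 = 1 then (1 : L) else 0),
                  Measure (Subgroup.centralizer ({γH} : Set (UnitaryGroup.arch (↥(maximalRealSubfield L)) L (IsCMField.complexConj L) 2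
                      (Matrix.of fun i j : Fin 2 => if i.val + j.val + 1 = 2 then (1 : L) else 0) ×
                    UnitaryGroup.arch (↥(maximalRealSubfield L)) L (IsCMField.complexConj L) 1
                      (Matrix.of fun i j : Fin 1 => if i.val + j.val + 1 = 1 then (1 : L) else 0)))))
            (hherm : (H'.map (cmConjRingHom L)).transpose = H')
            (hCTM : CanonicalTransferMatrix L H' Tinf.Δ νH νG Sbad Δ mH mG)
            (hACS : ArchCanonicalSingularMatrix L H' Tinf νGi νqi νHi hanis m' m mHi t' t tH),
    ∀ (μ : Literature.NumberTheory.GaloisRepresentations.HeckeCharacter L) (hμu : μ.IsUnitary)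
      (hμω : ∀ x : Literature.NumberTheory.GaloisRepresentations.ideleGroup ↥(maximalRealSubfield L),
        μ (AdeleRing.ideleBaseChange (↥(maximalRealSubfield L)) L x) = quadraticHeckeCharCM L x)
      (hΔ : Δ = finExplicitCollection L H' μ (finExplicitDelta_conj_left_all L H' μ) (finExplicitDelta_conj_right_all L H' μ))
      (hTinf : Tinf = archCanonicalTransferFactor L H' μ),
              ∀ (γ₀ : (UnitaryGroup.cmDatum L 3 H').Rational) (e₁ e₂ : L), e₁ ≠ e₂ →
                ((((γ₀ : unitaryGroup (cmConjRingHom L) H').val : GL (Fin 3) L) : Matrix (Fin 3) (Fin 3) L) - e₁ • (1 : Matrix (Fin 3) (Fin 3) L)) * ((((γ₀ : unitaryGroup (cmConjRingHom L) H').val : GL (Fin 3) L) : Matrix (Fin 3) (Fin 3) L) - e₂ • (1 : Matrix (Fin 3) (Fin 3) L)) = 0 →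
                (¬ ∃ ζ : L, (((γ₀ : unitaryGroup (cmConjRingHom L) H').val : GL (Fin 3) L) : Matrix (Fin 3) (Fin 3) L) = ζ • (1 : Matrix (Fin 3) (Fin 3) L)) →
                (((γ₀ : unitaryGroup (cmConjRingHom L) H').val : GL (Fin 3) L) : Matrix (Fin 3) (Fin 3) L).charpoly =
                  (Polynomial.X - Polynomial.C e₁) ^ 2 * (Polynomial.X - Polynomial.C e₂) →
                ∀ (γH : (UnitaryGroup.cmDatum L 2 (Matrix.of fun i j : Fin 2 => if i.val + j.val + 1 = 2 then (1 : L) else 0)).Rational ×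
                    (UnitaryGroup.cmDatum L 1 (Matrix.of fun i j : Fin 1 => if i.val + j.val + 1 = 1 then (1 : L) else 0)).Rational),
                  (((γH.1 : unitaryGroup (cmConjRingHom L) (Matrix.of fun i j : Fin 2 => if i.val + j.val + 1 = 2 then (1 : L) else 0)).val : GL (Fin 2) L) : Matrix (Fin 2) (Fin 2) L) =
                    e₁ • (1 : Matrix (Fin 2) (Fin 2) L) →
                  (((γH.2 : unitaryGroup (cmConjRingHom L) (Matrix.of fun i j : Fin 1 => if i.val + j.val + 1 = 1 then (1 : L) else 0)).val : GL (Fin 1) L) : Matrix (Fin 1) (Fin 1) L) 0 0 = e₂ →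
                  (∃ cinf : ℂ, cinf ≠ 0 ∧
                    (∀ (aH : UnitaryGroup.arch (↥(maximalRealSubfield L)) L (IsCMField.complexConj L) 2 (Matrix.of fun i j : Fin 2 => if i.val + j.val + 1 = 2 then (1 : L) else 0) ×
                            UnitaryGroup.arch (↥(maximalRealSubfield L)) L (IsCMField.complexConj L) 1 (Matrix.of fun i j : Fin 1 => if i.val + j.val + 1 = 1 then (1 : L) else 0) → ℂ)
                          (a : UnitaryGroup.arch (↥(maximalRealSubfield L)) L (IsCMField.complexConj L) 3 H' → ℂ),
                        ArchSmooth L 3 H' a → ArchSmooth₂ L aH → IsArchDeltaTransfer L H' Tinf mHi m' aH a →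
                        archStableOrbitalIntegral L 3 H' (Literature.NumberTheory.Weil1964.UnitaryArchTopForm.archSingularTopFormFamily L H' νGi) a (cmRationalToArch L 3 H' γ₀) =
                          cinf * aH (cmRationalToArch L 2 (Matrix.of fun i j : Fin 2 => if i.val + j.val + 1 = 2 then (1 : L) else 0) γH.1, cmRationalToArch L 1 (Matrix.of fun i j : Fin 1 => if i.val + j.val + 1 = 1 then (1 : L) else 0) γH.2))) →
                  ∃ cinf : ℂ, (∃ r : ℝ, r ≠ 0 ∧ cinf * Tinf.Δ (cmRationalToArch L 2 (Matrix.of fun i j : Fin 2 => if i.val + j.val + 1 = 2 then (1 : L) else 0) γH.1, cmRationalToArch L 1 (Matrix.of fun i j : Fin 1 => if i.val + j.val + 1 = 1 then (1 : L) else 0) γH.2) (cmRationalToArch L 3 H' γ₀) = (r : ℂ)) ∧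
                    (∀ (aH : UnitaryGroup.arch (↥(maximalRealSubfield L)) L (IsCMField.complexConj L) 2 (Matrix.of fun i j : Fin 2 => if i.val + j.val + 1 = 2 then (1 : L) else 0) ×
                            UnitaryGroup.arch (↥(maximalRealSubfield L)) L (IsCMField.complexConj L) 1 (Matrix.of fun i j : Fin 1 => if i.val + j.val + 1 = 1 then (1 : L) else 0) → ℂ)
                          (a : UnitaryGroup.arch (↥(maximalRealSubfield L)) L (IsCMField.complexConj L) 3 H' → ℂ),
                        ArchSmooth L 3 H' a → ArchSmooth₂ L aH → IsArchDeltaTransfer L H' Tinf mHi m' aH a →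
                        archStableOrbitalIntegral L 3 H' (Literature.NumberTheory.Weil1964.UnitaryArchTopForm.archSingularTopFormFamily L H' νGi) a (cmRationalToArch L 3 H' γ₀) =
                          cinf * aH (cmRationalToArch L 2 (Matrix.of fun i j : Fin 2 => if i.val + j.val + 1 = 2 then (1 : L) else 0) γH.1, cmRationalToArch L 1 (Matrix.of fun i j : Fin 1 => if i.val + j.val + 1 = 1 then (1 : L) else 0) γH.2))  := by
  intro hK hanis Sbad Δ mH mG m' m mHi t' t tH hherm hCTM hACS μ hμu hμω hΔ hTinf γ₀ e₁ e₂ hne hγ hnsc hchar γH h1 h2 h9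
  classical
  obtain ⟨cinf, hc0, hid⟩ := h9
  subst hTinf
  -- names for the archimedean points `γ_H ⊗ 1`, `γ₀ ⊗ 1` (plain equations; no abstraction over the frame)
  obtain ⟨γHa, hγHa⟩ : ∃ γHa : (↥(UnitaryGroup.arch (↥(maximalRealSubfield L)) L (IsCMField.complexConj L) 2 (Matrix.of fun i j : Fin 2 => if i.val + j.val + 1 = 2 then (1 : L) else 0)) ×
        ↥(UnitaryGroup.arch (↥(maximalRealSubfield L)) L (IsCMField.complexConj L) 1 (Matrix.of fun i j : Fin 1 => if i.val + j.val + 1 = 1 then (1 : L) else 0))),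
      γHa = (cmRationalToArch L 2 (Matrix.of fun i j : Fin 2 => if i.val + j.val + 1 = 2 then (1 : L) else 0) γH.1,
        cmRationalToArch L 1 (Matrix.of fun i j : Fin 1 => if i.val + j.val + 1 = 1 then (1 : L) else 0) γH.2) := ⟨_, rfl⟩
  obtain ⟨γ₀a, hγ₀a⟩ : ∃ γ₀a : ↥(UnitaryGroup.arch (↥(maximalRealSubfield L)) L (IsCMField.complexConj L) 3 H'), γ₀a = cmRationalToArch L 3 H' γ₀ := ⟨_, rfl⟩
  rw [← hγHa, ← hγ₀a] at hid ⊢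
  -- ★ §B at the semiregular pair
  have hΔ0 : (archCanonicalTransferFactor L H' μ).Δ γHa γ₀a ≠ 0 := by
    rw [hγHa, hγ₀a]; exact archCanonicalDelta_ne_zero_of_semiregular L H' hne hγ hchar h1 h2 μ hherm hanis
  obtain ⟨r₀, hr₀⟩ := exists_archCanonicalDelta_eq_archTau_mul_ofReal L H' μ γHa γ₀a
  have hunit : IsUnit ((archCharpolyTwo L γHa).eval (archGammaTwo L γHa)) := by
    rw [hγHa]; exact isUnit_eval_archCharpolyTwo_of_semiregular L hne h1 h2
  have hτ : conj (archTau L γHa μ) * archTau L γHa μ ^ 2 = archTau L γHa μ := conj_archTau_mul_archTau_sq L γHa hμu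
  -- the clauses of `hACS` that are used: (iii) admissibility of `mHi` on the `G`-regular classes, (vi) existence of smooth `Δ‴_∞`-transfers
  obtain ⟨-, -, hadmH, -, -, hex6, -⟩ := hACS
  by_cases hex : ∃ (aH : (↥(UnitaryGroup.arch (↥(maximalRealSubfield L)) L (IsCMField.complexConj L) 2 (Matrix.of fun i j : Fin 2 => if i.val + j.val + 1 = 2 then (1 : L) else 0)) ×
        ↥(UnitaryGroup.arch (↥(maximalRealSubfield L)) L (IsCMField.complexConj L) 1 (Matrix.of fun i j : Fin 1 => if i.val + j.val + 1 = 1 then (1 : L) else 0))) → ℂ)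
      (a : ↥(UnitaryGroup.arch (↥(maximalRealSubfield L)) L (IsCMField.complexConj L) 3 H') → ℂ),
      ArchSmooth L 3 H' a ∧ ArchSmooth₂ L aH ∧ IsArchDeltaTransfer L H' (archCanonicalTransferFactor L H' μ) mHi m' aH a ∧ aH γHa ≠ 0
  swap
  · -- every smooth pair vanishes at `γ_H ⊗ 1`: any constant works, take `conj Δ₀`
    refine ⟨conj ((archCanonicalTransferFactor L H' μ).Δ γHa γ₀a), ⟨‖(archCanonicalTransferFactor L H' μ).Δ γHa γ₀a‖ ^ 2, ?_, ?_⟩, fun aH a ha haH hp => ?_⟩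
    · exact pow_ne_zero 2 (norm_ne_zero_iff.2 hΔ0)
    · rw [Complex.conj_mul', Complex.ofReal_pow]
    · have h0 : aH γHa = 0 := by
        by_contra h
        exact hex ⟨aH, a, ha, haH, hp, h⟩
      rw [hid aH a ha haH hp, h0, mul_zero, mul_zero]
  obtain ⟨aH, a, ha, haH, hp, hne0⟩ := hex
  refine ⟨cinf, ?_, hid⟩
  -- (1) a smooth transfer `bH` of `conj ∘ a`
  have hb : ArchSmooth L 3 H' (star a) := ArchSmooth.star L 3 H' ha
  obtain ⟨bH, hbH, hbp⟩ := hex6 (star a) hb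
  -- (2) the smooth class cut-off (★ §C) and its invariances
  obtain ⟨χ, hχ1, hχst, hχmul, hχτ⟩ := exists_smooth_class_cutoff L μ γHa hunit
  have hχconj : ∀ x y : (↥(UnitaryGroup.arch (↥(maximalRealSubfield L)) L (IsCMField.complexConj L) 2 (Matrix.of fun i j : Fin 2 => if i.val + j.val + 1 = 2 then (1 : L) else 0)) ×
        ↥(UnitaryGroup.arch (↥(maximalRealSubfield L)) L (IsCMField.complexConj L) 1 (Matrix.of fun i j : Fin 1 => if i.val + j.val + 1 = 1 then (1 : L) else 0))),
      χ (y * x * y⁻¹) = χ x := fun x y => hχst x _ (isArchStablyConjH_conj L x y)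
  -- (3) the twisted difference `d = χ·bH − χ·τ²·conj aH ∈ C_c^∞(H_∞)` is a transfer of `0` (§1)
  have hsd₁ : ArchSmooth₂ L (fun k => χ k * bH k) := hχmul bH hbH
  have hsd₂ : ArchSmooth₂ L ((-1 : ℂ) • fun k => χ k * (archTau L k μ ^ 2 * star aH k)) := by
    have h := hχτ (star aH) (ArchSmooth₂.star L haH)
    have e : ((-1 : ℂ) • fun k => χ k * (archTau L k μ ^ 2 * star aH k)) = -fun k => χ k * archTau L k μ ^ 2 * star aH k := by
      funext k; simp [mul_assoc]
    rw [e]; exact ArchSmooth₂.neg h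
  have hsd : ArchSmooth₂ L ((fun k => χ k * bH k) + (-1 : ℂ) • fun k => χ k * (archTau L k μ ^ 2 * star aH k)) := ArchSmooth₂.add hsd₁ hsd₂
  have hpd := isArchDeltaTransfer_cutoff_sub_zero L H' μ hμu hadmH m' hp hbp hχconj hχst hsd₁ hsd₂
  -- (4) #9 on `(d, 0)`: `d(γ_H ⊗ 1) = 0`, i.e. `bH(γ_H ⊗ 1) = τ² · conj aH(γ_H ⊗ 1)`
  have h0d := hid _ 0 (archSmooth_zero L 3 H') hsd hpd
  dsimp only [archStableOrbitalIntegral] at h0d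
  rw [stableOrbitalIntegralRel_zero] at h0d
  have hdγ : ((fun k => χ k * bH k) + (-1 : ℂ) • fun k => χ k * (archTau L k μ ^ 2 * star aH k)) γHa = 0 := by
    rcases mul_eq_zero.1 h0d.symm with h | h
    · exact absurd h hc0
    · exact h
  have hbval : bH γHa = archTau L γHa μ ^ 2 * conj (aH γHa) := by
    have h := hdγ
    simp only [Pi.add_apply, Pi.smul_apply, smul_eq_mul, hχ1, one_mul, Pi.star_apply] at h
    linear_combination h
  -- (5) #9 on `(bH, conj ∘ a)` and on `(aH, a)`: `conj c_∞ = c_∞ · τ²`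
  have e1 := hid bH (star a) hb hbH hbp
  have e2 := hid aH a ha haH hp
  dsimp only [archStableOrbitalIntegral] at e1 e2
  rw [stableOrbitalIntegralRel_star, e2, map_mul, hbval] at e1
  have hcc : conj cinf = cinf * archTau L γHa μ ^ 2 := by
    have hne' : conj (aH γHa) ≠ 0 := (map_ne_zero (starRingEnd ℂ)).2 hne0
    exact mul_right_cancel₀ hne' (by rw [e1]; ring)
  -- (6) `c_∞ · Δ₀` is real and non-zero
  have hreal : conj (cinf * (archCanonicalTransferFactor L H' μ).Δ γHa γ₀a) = cinf * (archCanonicalTransferFactor L H' μ).Δ γHa γ₀a := by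
    rw [hr₀, map_mul, map_mul, hcc, Complex.conj_ofReal]
    linear_combination cinf * (r₀ : ℂ) * hτ
  refine ⟨(cinf * (archCanonicalTransferFactor L H' μ).Δ γHa γ₀a).re, fun h => mul_ne_zero hc0 hΔ0 ?_, (Complex.conj_eq_iff_re.1 hreal).symm⟩
  rw [← Complex.conj_eq_iff_re.1 hreal, h, Complex.ofReal_zero]

end Frame

end Summit.HodgeConjecture.HodgeConjecture.Cruxes.H413.K2E4ExplicitArchConstantPhaseOfKappaArch

end
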